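import Summits.ResolutionOfSingularities.ResolutionOfSingularities.Theses.FoliationDescent
import Literature.AlgebraicGeometry.Resolution.AbhyankarValuationsLocalUniformization
import Literature.AlgebraicGeometry.Resolution.ResolutionLU
import Literature.AlgebraicGeometry.Resolution.RankOneReduction
import Summits.ResolutionOfSingularities.ResolutionOfSingularities.Theorems.LogCanQuotLU.Negative.WithoutRegularTop
import Summits.ResolutionOfSingularities.ResolutionOfSingularities.Theorems.LogCanQuotLU.Negative.WithoutGNeZero
import Summits.ResolutionOfSingularities.ResolutionOfSingularities.Theorems.LogCanQuotLU.Negative.WithoutDichotomy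
import Summits.ResolutionOfSingularities.ResolutionOfSingularities.Theorems.LogCanQuotLU.Negative.FalseWithoutFG
import Summits.ResolutionOfSingularities.ResolutionOfSingularities.Theorems.LogCanQuotLU.Negative.PlaneWitness
import Summits.ResolutionOfSingularities.ResolutionOfSingularities.Theorems.LogCanQuotLU.Negative.HypothesesInhabited
import Summits.ResolutionOfSingularities.ResolutionOfSingularities.Theorems.LogCanQuotLU.Negative.ConstantsNotRegularMultiplicative
import Summits.ResolutionOfSingularities.ResolutionOfSingularities.Theorems.LogCanQuotLU.Negative.MultiplicativeTwistNotSplit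
import HarnessLib

/-!
# Disproof of `LogCanQuotLU` — findings: NO KILL; the summit implies the crux; the two
# load-bearing hypotheses (regular top, log-canonical dichotomy) each carry the whole open problem;
# without `S'.FG` / `Frac S' = K` / `R`-constancy the crux is FALSE; the hypotheses are inhabited
# in both regimes; in the multiplicative regime `A := S'^D` is NOT regular (A₁) and `u` is NOT
# normalisable to `1` by a unit of `S'_c` (twisted μ₃) — all kernel-checked

Crux `FoliationDescent.LogCanQuotLU` (stmt-ResolutionOfSingularities-17082), refuter work file
(crux-attack cycle 1, refuter-rattack-stmt-ResolutionOfSingularities-17082-0, 2026-08-17; no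
cdisprove seat had written a `Disproof.lean` before). Index of findings:

1. `logCanQuotLU_of_resolutionOfSingularities : ResolutionOfSingularities → LogCanQuotLU` —
   **S → C**: the crux is a CONSEQUENCE of the summit (resolution in char `p` ⇒ relative local
   uniformization of every function field, `ResolutionInChar.relLocalUniformization`, applied
   to the constant field `K^D` along `O ∩ K^D`). Hence NO unconditional `¬ LogCanQuotLU` can
   exist unless `ResolutionOfSingularities` is false: the crux cannot be refuted, only proved.
2. `logCanQuotLU_body_of_relLU` — the core transport; it uses NONE of the foliation hypotheses
   (`S'` regular at the centre, `D ≠ 0`, `p`-closedness, `g ≠ 0`, preservation of `S'_c`,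
   non-singular ∨ multiplicative) and not `PerfectField k`: all of these are idle for TRUTH and
   load-bearing only for PROVABILITY. Only `S'.FG ∧ IsFractionRing S' K` (finite generation of
   `K`, hence of `K^D`: `constField_fg`) is load-bearing for truth.
3. `logCanQuotLU_of_relLUPerfect`, `logCanQuotLU_of_torsorLUPerfect_of_torsorToLurelPerfect` —
   in route vocabulary: plain relative LU over perfect fields (the hypothesis of the route's
   `PatchingRelPerfect p` = conclusion of `TorsorToLurelPerfect p`) gives the crux; so do the
   route's TARGET `TorsorLUPerfect` and its Temkin crux together. (Converse direction, in tree: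
   `Theorems/PAlterationPialtBridgeFoliationDescent.lean`,
   `Temkin2013 ∧ FolLU ∧ LogCanQuotLU ⇒ LU over perfect k`.)
4. (paper, see the crux-attack report attached to the item) cheap probes `exact? | aesop` on
   `LogCanQuotLU`, `LogCanQuotLU → ResolutionOfSingularities`, `→ FolLU`, `→ TorsorLUPerfect`
   all FAIL; non-vacuity witnesses in the three regimes (trivial valuation / non-singular /
   singular multiplicative `D = x∂ₓ`); tightness: `A := S'^D` is NOT regular in the
   multiplicative case (`p = 2`, `D = x∂ₓ + y∂_y` on `𝔽₂[x,y]`: constants `𝔽₂[x², xy, y²]`, an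
   `A₁` point), so stub 2's conclusion does not extend to the multiplicative disjunct; and the
   multiplicative half is IN PRINT modulo translation: singular multiplicative `δ` on the regular
   `B = S'_c` (`δ^p = uδ`, `u ∈ B^×` is automatically a `δ`-constant) = action of the height-one
   twisted form `G_u` of `μ_p` (split over the finite étale `B^δ[u^{1/(p-1)}]`), `B^δ = B^{G_u}`;
   so `Spec S'^D` near the centre is a variety over the PERFECT field `k` with finite tame
   quotient singularities (étale-locally `U/μ_p`, `U` smooth), and D. Bergh – D. Rydh,
   arXiv:1905.00872, Introduction, Theorem "Resolution of tame quotient singularities" (with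
   Remark "Projectivity"), built on D. Bergh, Compositio Math. 153 (2017) = arXiv:1409.5713,
   Theorem "Functorial destackification", gives a resolution by BLOW-UPS `X' → Spec S'^D[1/h^p]`
   with `X'` smooth — at every (also non-closed) centre; the valuation's centre on `X'` yields `A`.
   Lean cost: XL unless that theorem is vendored (no stacks in Mathlib); see the report for the
   étale-descent subtlety of a hand-made toric proof.

Positive lemmas only (evidence for planner / prover); nothing in §§1–4 is a Theorems landing.

## §5 cdisprove cycle 1 (refuter-cdisprove-stmt-ResolutionOfSingularities-17082-0, 2026-08-17):
## LOAD-BEARING ANALYSIS — which hypotheses keep the crux from BEING local uniformization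

Since no hypothesis is load-bearing for truth (§§1–2), `logCanQuotLU_false_without_<H>` theorems
are out of reach (each would refute LU). The substitute, LANDED under
`Theorems/LogCanQuotLU/Negative/` (`Transport.lean` p152984, `WithoutGNeZero.lean` p153021,
`WithoutRegularTop.lean`) and re-exported here by name:

5. `LogCanQuotLUWithoutRegularTop` (the crux with ONLY "`S'` regular at the centre" deleted) is
   EQUIVALENT to relative LU over perfect fields: `withoutRegularTop_iff_relLUPerfect :
   LogCanQuotLUWithoutRegularTop ↔ ∀ p, p.Prime → RelLUPerfectAt p` (→ is the new theorem
   `Negative.relLU_perfect_of_logCanQuotLU_withoutRegularTop`: for `R ⊆ O ⊆ K` take `a ∈ O` not a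
   `p`-th power, `L = K(a^{1/p})`, `D = d/dy`, the NON-REGULAR model `S' = R₁[y]`, non-singular
   because `D y = 1`; the conclusion is a regular model of `ker D = K` over `R`; ← is §2). Hence
   `resolutionOfSingularities_of_withoutRegularTop_patching_descent`: WithoutRegularTop +
   `PatchingRelPerfect` + `DescentPerfectToAll` ⇒ summit, bypassing `FolLU`, `DualSandwich`,
   `TorsorLUPerfect`, `TorsorToLurelPerfect`. ANY PROOF OF THE CRUX MUST USE THE REGULAR TOP.
6. `LogCanQuotLUWithoutGNeZero` (ONLY "`g ≠ 0`" deleted; `g := 0` trivialises the preservation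
   and MULTIPLICATIVE clauses) gives RRLU1 over perfect fields with NO foliation input
   (`Negative.rrLU1_perfect_of_logCanQuotLU_withoutGNeZero`, the bridge of
   `Theorems/PAlterationPialtBridgeFoliationDescent.lean` with `S' := B`), hence with `Temkin2013`
   LU of every finitely generated extension of every perfect field
   (`isLocallyUniformizable_perfect_of_temkin2013_withoutGNeZero`). ANY PROOF MUST USE `g ≠ 0`,
   i.e. must use the log-canonical disjunction non-trivially. Sharper (`Negative/WithoutDichotomy.lean`
   p154577): keep `g ≠ 0` AND the preservation of `S'_c`, delete ONLY the dichotomy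
   "non-singular ∨ multiplicative" — still RRLU1-perfect (`g :=` a common denominator of `d/dy` on
   generators of the regular `B`, `Negative.exists_smul_derivation_map_mem`), hence (Temkin) LU
   over perfect fields: `isLocallyUniformizable_perfect_of_temkin2013_withoutDichotomy`. So the
   preservation clause is cheap and the DICHOTOMY is the load-bearing part of "log-canonical".
7. `D ≠ 0` is idle: `withoutDNeZero_iff : LogCanQuotLUWithoutDNeZero ↔ LogCanQuotLU` (at `D = 0`
   take `A := S'`; `Negative.logCanQuotLU_body_of_derivation_zero`). Provers may drop it.
8. Structure lemma for the multiplicative clause: the "eigenvalue" `u` in `(g•D)^[p] = u · (g•D)`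
   is AUTOMATICALLY a constant (`apply_eq_zero_of_iterate_eq_mul`: `E ≠ 0`, `E^[p] = u E ⇒
   E u = 0`, from `E ∘ E^[p] = E^[p] ∘ E` and Leibniz) — so the twisted form `G_u` of `μ_p` in §4
   is defined over the constants, as the toric normal form needs.
9. GENUINE FALSITIES (the only kind available): `not_withoutFG : ¬ LogCanQuotLUWithoutFG` and
   `not_withoutIsFractionRing` (p155141, landed) — the crux with ONLY `S'.FG`, resp. ONLY
   `IsFractionRing S' K`, deleted is FALSE (`Negative/FalseWithoutFG.lean` p154860 / rev. 2
   p155141: `K = 𝔽₂(X₀, X₁, …)`, `O = K`, `D = ∂/∂X₀`, `2`-closed with `c = 0`, non-singular,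
   `S' = K` resp. `S' = k[X₀]`; the constants contain the algebraically independent `X₁, X₂, …`,
   so no finitely generated `A` has `Frac A ⊇ K^D`). The two finiteness hypotheses are thus
   EXACTLY the hypotheses load-bearing for TRUTH, confirming §2's reading from the other side.
10. `-- Targets`: none assigned this cycle (payload `targets = []`, no line picked). Pre-emptive
   reading of line `birth` (`Lines/birth.lean`): `stub_constantsFG` and `stub_nonsingularDescent`
   are TRUE as typed (paper proofs in their docstrings check: finiteness over `k[S'^p]`; Taylor
   projection needs exactly `p`-closedness + `δ x = 1`, cf. the landed counterexample WITHOUT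
   `p`-closedness `Theorems/DescentPerfectToAll/Negative/InvariantsRegularOfNonsingularDerivationFalse.lean`);
   `stub_multiplicativeToricLU` is a sub-case of relative LU of `K^D` (implied by `RelLUPerfectAt p`
   exactly as in §2), so it cannot be killed either; its risk is formalization cost only.

## §6 cdisprove gen 2, cycle 1 (refuter-cdisprove-stmt-ResolutionOfSingularities-17082-g2-0,
## 2026-08-17): the paper-only findings of §4/§10 KERNEL-CHECKED, on the plane witness

All on `k[X₀, X₁] ⊆ k(X₀, X₁)` with a valuation ring `O` DOMINATING the origin (Chevalley), LANDED
under `Theorems/LogCanQuotLU/Negative/` and re-exported below by name: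

11. `Negative/PlaneWitness.lean` (p162620) — bookkeeping: `exists_valuationSubring_dominating_origin`
   (`S' ≤ O`, `β(0) ≠ 0 ⇒ β⁻¹ ∈ O`, `β(0) = 0 ∧ β⁻¹ ∈ O ⇒ β = 0`), the polynomial model is f.g.,
   `Frac = K`, REGULAR AT EVERY CENTRE (`plane_isRegularLocalRing_centre`, Mathlib's
   `IsRegularRing (MvPolynomial _ k)`), `S'_c = {α/β : β(0) ≠ 0}` (`plane_memSc_iff`), derivations of
   `K` are determined on `X₀, X₁` and a derivation restricting to `k[X]` preserves `S'_c`; the Euler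
   field `E = X₀∂₀ + X₁∂₁` in char `2` (`E ∘ E = E`) and `∂₀` (`∂₀ ∘ ∂₀ = 0`).
12. NON-VACUITY with ALL finiteness clauses over a NON-trivial `O` (`Negative/HypothesesInhabited.lean`,
   p162934): `not_hypsContradictory_nonsingular` (`p = 2`, `D = ∂₀`, `g = 1`, `R = k`) and
   `not_hypsContradictory_singularMultiplicative` (`p = 2`, Euler field: the multiplicative clause
   holds with `u = 1` AND the non-singular clause FAILS — the regime where stub 3 of line `birth`
   has content). The §9 witnesses violate `S'.FG` / `Frac S' = K` by design; these do not.
13. `not_withoutRConst : ¬ LogCanQuotLUWithoutRConst` (same file) — deleting ONLY "`D = 0` on `R`"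
   makes the crux FALSE (`R := S' ∋ X₀`, `D X₀ = 1`). With §9 (`S'.FG`, `IsFractionRing`, now both
   re-exported: `not_withoutFG`, `not_withoutIsFractionRing`) this completes the list of hypotheses
   that are load-bearing for TRUTH: exactly the typing/finiteness clauses. (`R ≤ S'` can likewise
   only be weakened to `R ⊆ O`, not deleted — not filed, trivial; `R.FG` is idle given stub 1.)
14. TIGHTNESS, kernel-checked (`Negative/ConstantsNotRegularMultiplicative.lean`, p163011):
   `not_constantsRegularMult : ¬ LogCanQuotLUConstantsRegularMult` — `Sig.stub_nonsingularDescent`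
   of line `birth` with its non-singular clause replaced by the MULTIPLICATIVE clause is FALSE:
   `p = 2`, Euler field, `A = S'^E = 𝔽₂[X₀², X₀X₁, X₁²]` (the `A₁` point): in `A_𝔭` the element `X₀²`
   lies in `𝔪 ∖ 𝔪²` (a product of two constants without constant term has no `X₀²`-term) but is not
   prime (`X₀² ∣ (X₀X₁)²`, `X₀² ∤ X₀X₁`), against Matsumura 14.3 (`IsRegularLocalRing.prime_of_not_mem_sq`,
   tree). Abstract form: `Negative.not_isRegularLocalRing_atPrime_of_cone`. So stubs 2 and 3 of
   `birth` cannot be merged: the multiplicative half needs a genuine enlargement of `S'^D` (blow-up).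
15. THE TWIST, kernel-checked (`Negative/MultiplicativeTwistNotSplit.lean`, p163514):
   `not_multUnitNormalisation : ¬ LogCanQuotLUMultUnitNormalisation` — "some UNIT `h` of `S'_c`
   rescales `g•D` to an idempotent derivation `((hg)•D)^p = (hg)•D`" (= the twisted form `G_u` of
   `μ_p` of §4/§8 splits Zariski-locally) is FALSE, even at singular multiplicative points:
   `p = 3`, rotation field `D = -X₁∂₀ + X₀∂₁` on `𝔽₃(X₀, X₁)` (`D³ = -D`, `u = -1`):
   `(hD)³ = hD` at `X₁` forces `(Dh)² + h·D²h - h² = 1` (Hochschild for `p = 3`,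
   `Negative.rescaling_identity_char_three`), whose constant term reads `-β(0)²(α(0)² + β(0)²) = 0`,
   impossible in `𝔽₃`. The constants are the NON-SPLIT `A₂` point `𝔽₃[X₀³, X₁³, X₀² + X₁²]`; `G_{-1}`
   splits over `S'_c[i]` only. CONSEQUENCE FOR STUB 3: a proof must uniformize the GALOIS-TWISTED
   toric quotient over the residue field itself (Brylinski/Γ-invariant fan subdivision) or construct
   the local blow-up on the étale cover `S'_c[u^{1/(p-1)}]` and DESCEND it — the printed normal form
   (`δ^p = δ`, algebraically closed residue field) is not available on `S'_c`.

16. CITATION PINNED for stub 3 (read this cycle, `lit read arxiv:1905.00872`, p. 4): D. Bergh,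
   D. Rydh, *Functorial destackification and weak factorization of orbifolds*, arXiv:1905.00872,
   **Theorem 5 (Resolution of tame quotient singularities)**: "Let `k` be a PERFECT field and let
   `X` be a variety over `k` with finite tame quotient singularities [étale-locally on `X`,
   `X = U/G` with `G` a finite linearly reductive group scheme over `k` and `U` smooth over `k`].
   Then there exists a sequence of blow-ups `X' = X_n → … → X_0 = X` such that `X'/k` is smooth.
   Moreover, this sequence is functorial with respect to field extensions and smooth morphisms."
   (Proof: Satriano's canonical stack `X_can → X` [ANT 6 (2012)] + their destackification theorem.)
   It applies to `X = Spec (S'^D)_f` in the multiplicative case: over the finite étale cover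
   `C' = C[h]/(h^{p-1} - u⁻¹)` of the constants (`u` is a constant, §8) the twisted action becomes a
   `μ_p`-action (`μ_p` is defined over the prime field) on `U = Spec (S'_f ⊗_C C')`, smooth over the
   PERFECT `k` — exactly the route's `[PerfectField k]`; so the multiplicative half is "in print"
   as Theorem 5 + (valuative criterion: centre of `O ∩ K^D` on `X'`), with NO splitting of `G_u`
   needed (item 15 only obstructs the hand-made Zariski-local normal form, not this route).

Attacks of this cycle that produced nothing new (recorded for the census): every
`_false_without_<foliation hypothesis>` (regular top, `g ≠ 0`, dichotomy, preservation, `p`-closed,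
`PerfectField`) is LU-strength by §§2, 5–6 (unrefutable); dropping preservation alone is symmetric
to §6 (choose `g := (D x₀)⁻¹` to make the non-singular clause hold) and was not filed separately.
At NON-CLOSED centres the multiplicative normal form survives (paper, for the provers): with
`∂(B) ⊆ 𝔪_B` the induced `κ(𝔭)`-LINEAR map `T` on `𝔪/𝔪²` has `T^p = ū T`, so after the finite
étale `B' = B[h]/(h^{p-1} - u⁻¹)` (`∂h = 0`, §8) `∂' = h∂` gives a `ℤ/p`-grading of `B̂'` with
homogeneous regular parameters and a coefficient field inside the constants: `B̂'^{∂'} = L⟦x⟧^{μ_p}`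
with `L ≅ κ(𝔭)` — toric over the residue field at every centre; what is NOT automatic is the
descent from `B'`/`B̂'` to `B` (item 15).

WHY IT RESISTS (for the provers, updated gen 2): the crux is sandwiched `RelLUPerfect ⇒ crux` (§2)
and `crux − {regular top} ⇔ RelLUPerfect`, `crux − {g ≠ 0} ⇒ RRLU1-perfect` (§5–6): every cheap
attack lands on an open problem, never on a falsity; the hypotheses are genuinely inhabited in both
regimes (§6.12), so nothing is vacuous. The only FALSE statements in this crux's orbit are (i) the
deletions of typing/finiteness clauses (§9, §6.13) and (ii) strengthenings of the MECHANISM of the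
multiplicative half, now kernel-checked: `A := S'^D` is not regular there (§6.14, the `A₁` cone) and
the eigenvalue `u` cannot be normalised away by a unit of `S'_c` (§6.15, the twisted `μ₃`). A proof
of stub 3 must therefore (a) blow up inside `K^D` and (b) handle non-split forms of `μ_p` — e.g. via
Bergh–Rydh destackification of `[Spec S'_f / G_u]` (arXiv:1905.00872, "Resolution of tame quotient
singularities"; §4), which is intrinsic and needs no splitting, or via a Galois-equivariant toric
subdivision descended from `S'_c[u^{1/(p-1)}]`.
-/

-- single-problem summit: the doubled namespace component `ResolutionOfSingularities` is forced
set_option linter.dupNamespace false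

noncomputable section

open IsLocalRing
open Literature.AlgebraicGeometry.Resolution
open Summit.ResolutionOfSingularities.ResolutionOfSingularities.Theses.FoliationDescent

namespace Summit.ResolutionOfSingularities.ResolutionOfSingularities.Cruxes.LogCanQuotLU.Disproof

/-! ## The field of constants of a derivation -/

/-- The field of constants `K^D = {x ∈ K | D x = 0}` of a `k`-derivation of a field `K`, as an
intermediate field of `K/k`. [folklore] -/
def constField {k K : Type} [Field k] [Field K] [Algebra k K] (D : Derivation k K K) :
    IntermediateField k K where
  carrier := {x | D x = 0}
  mul_mem' {a b} ha hb := by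
    simp only [Set.mem_setOf_eq] at ha hb ⊢
    rw [Derivation.leibniz, ha, hb, smul_zero, smul_zero, add_zero]
  one_mem' := by simp
  add_mem' {a b} ha hb := by
    simp only [Set.mem_setOf_eq] at ha hb ⊢
    rw [map_add, ha, hb, add_zero]
  zero_mem' := by simp
  algebraMap_mem' c := by simp
  inv_mem' x hx := by
    simp only [Set.mem_setOf_eq] at hx ⊢
    rw [Derivation.leibniz_inv, hx, smul_zero]

theorem mem_constField {k K : Type} [Field k] [Field K] [Algebra k K] (D : Derivation k K K)
    (x : K) : x ∈ constField D ↔ D x = 0 := Iff.rfl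

/-- `p`-th powers are constants in characteristic `p`. [folklore] -/
theorem derivation_pow_char {k K : Type} [Field k] [Field K] [Algebra k K] (p : ℕ) [CharP K p]
    (D : Derivation k K K) (x : K) : D (x ^ p) = 0 := by
  rw [D.leibniz_pow x p, nsmul_eq_mul, CharP.cast_eq_zero, zero_mul]

/-- **The field of constants of a finitely generated field is finitely generated**: if
`K = Frac S'` with `S' = k[s]` finitely generated and `char = p > 0`, then
`k(sᵖ) ⊆ K^D ⊆ K = k(s)` with `[K : k(sᵖ)] < ∞`, so `K^D` is finitely generated over `k`.
[folklore] -/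
theorem constField_fg {k K : Type} [Field k] [Field K] [Algebra k K] {p : ℕ} (hp : p.Prime)
    [CharP K p] (D : Derivation k K K) (S' : Subalgebra k K) (hS'fg : S'.FG)
    (hS'frac : IsFractionRing S' K) : (constField D).FG := by
  classical
  haveI := hS'frac
  obtain ⟨s, hs⟩ := hS'fg
  -- `K = k(s)`
  have htop : IntermediateField.adjoin k (s : Set K) = ⊤ := by
    apply top_le_iff.mp
    intro z _
    obtain ⟨a, b, -, rfl⟩ := IsFractionRing.div_surjective (A := S') z
    have ha : (a : K) ∈ IntermediateField.adjoin k (s : Set K) :=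
      IntermediateField.algebra_adjoin_le_adjoin k _ (by rw [hs]; exact a.2)
    have hb : (b : K) ∈ IntermediateField.adjoin k (s : Set K) :=
      IntermediateField.algebra_adjoin_le_adjoin k _ (by rw [hs]; exact b.2)
    exact div_mem ha hb
  -- `L₀ = k(sᵖ) ≤ K^D`
  set sp : Finset K := s.image (fun x : K => x ^ p) with hsp
  have hL₀L : IntermediateField.adjoin k (sp : Set K) ≤ constField D := by
    rw [IntermediateField.adjoin_le_iff]
    intro y hy
    obtain ⟨x, -, rfl⟩ := Finset.mem_image.mp (Finset.mem_coe.mp hy)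
    exact derivation_pow_char p D x
  -- `K` is finite over `L₀`
  have hint : ∀ x ∈ (s : Set K), IsIntegral (IntermediateField.adjoin k (sp : Set K)) x := by
    intro x hx
    have hxp : x ^ p ∈ IntermediateField.adjoin k (sp : Set K) :=
      IntermediateField.subset_adjoin k _
        (Finset.mem_coe.mpr (Finset.mem_image.mpr ⟨x, Finset.mem_coe.mp hx, rfl⟩))
    have h1 : IsIntegral (IntermediateField.adjoin k (sp : Set K))
        (algebraMap (IntermediateField.adjoin k (sp : Set K)) K ⟨x ^ p, hxp⟩) :=
      isIntegral_algebraMap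
    exact IsIntegral.of_pow hp.pos h1
  haveI hfin : FiniteDimensional (IntermediateField.adjoin k (sp : Set K)) K := by
    have h1 : FiniteDimensional (IntermediateField.adjoin k (sp : Set K))
        (IntermediateField.adjoin (IntermediateField.adjoin k (sp : Set K)) (s : Set K)) :=
      IntermediateField.finiteDimensional_adjoin hint
    have h2 : IntermediateField.adjoin (IntermediateField.adjoin k (sp : Set K)) (s : Set K) =
        ⊤ := by
      rw [← IntermediateField.restrictScalars_eq_top_iff (K := k),
        IntermediateField.restrictScalars_adjoin]
      apply top_le_iff.mp
      rw [← htop]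
      exact IntermediateField.adjoin.mono k _ _ Set.subset_union_right
    rw [h2] at h1
    exact LinearEquiv.finiteDimensional
      (IntermediateField.topEquiv (F := IntermediateField.adjoin k (sp : Set K))
        (E := K)).toLinearEquiv
  -- hence `K^D`, an intermediate field of `K / L₀`, is finitely generated over `L₀`, so over `k`
  obtain ⟨t, ht⟩ := IntermediateField.fg_of_noetherian (IntermediateField.extendScalars hL₀L)
  have e1 : (IntermediateField.adjoin (IntermediateField.adjoin k (sp : Set K))
      (t : Set K)).restrictScalars k = constField D := by
    rw [ht]
    rfl
  refine ⟨sp ∪ t, ?_⟩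
  rw [Finset.coe_union, ← IntermediateField.adjoin_adjoin_left, e1]

/-! ## The core: relative LU of the constant field gives the crux body -/

/-- **Core transport.** Fix `p` and `k`. If every finitely generated `K'/k` admits relative local
uniformization along every valuation ring `O' ⊇ k` (`RelLocalUniformization k K' O'`), then
the body of `LogCanQuotLU` holds at `p, k` for every `K, O, S', D, g, R` — apply it to the
constant field `K^D`, the valuation ring `O ∩ K^D` and the algebra generated by `R` and an
affine model of `K^D`, and transport the resulting regular model back into `K`. The foliation
hypotheses are not used. [folklore] -/
theorem logCanQuotLU_body_of_relLU {p : ℕ} (hp : p.Prime) (k K : Type) [Field k] [CharP k p]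
    [Field K] [Algebra k K]
    (H : ∀ (K' : Type) [Field K'] [Algebra k K'], (⊤ : IntermediateField k K').FG →
      ∀ O' : ValuationSubring K', (∀ c : k, algebraMap k K' c ∈ O') →
        RelLocalUniformization k K' O')
    (O : ValuationSubring K) (S' : Subalgebra k K) (h' : S'.toSubring ≤ O.toSubring)
    (D : Derivation k K K) (R : Subalgebra k K) (hS'fg : S'.FG) (hS'frac : IsFractionRing S' K)
    (hRfg : R.FG) (hRle : R ≤ S') (hRconst : ∀ x ∈ R, D x = 0) :
    ∃ (A : Subalgebra k K) (hA : A.toSubring ≤ O.toSubring), R ≤ A ∧ A.FG ∧ (∀ x ∈ A, D x = 0) ∧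
      (∀ x : K, D x = 0 → ∃ a b : K, a ∈ A ∧ b ∈ A ∧ b ≠ 0 ∧ x = a / b) ∧
      IsRegularLocalRing (Localization.AtPrime
        (Ideal.comap (Subring.inclusion hA) (IsLocalRing.maximalIdeal O))) := by
  classical
  haveI : Fact p.Prime := ⟨hp⟩
  haveI : CharP K p := charP_of_injective_algebraMap (algebraMap k K).injective p
  -- the field of constants `L = K^D`, finitely generated over `k`
  set L : IntermediateField k K := constField D with hLdef
  have hmemL : ∀ x : K, x ∈ L ↔ D x = 0 := fun x => Iff.rfl
  have hLfg : L.FG := constField_fg hp D S' hS'fg hS'frac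
  haveI : Algebra.EssFiniteType k L := IntermediateField.essFiniteType_iff.mpr hLfg
  have hLtop : (⊤ : IntermediateField k L).FG := IntermediateField.fg_top_iff.mpr ‹_›
  -- the restricted valuation ring `O ∩ L`
  set f : L →+* K := algebraMap L K with hf
  have hfinj : Function.Injective f := (algebraMap L K).injective
  set OL : ValuationSubring L := O.comap f with hOL
  have hOLk : ∀ c : k, algebraMap k L c ∈ OL := fun c => by
    rw [hOL, ValuationSubring.mem_comap, hf, ← IsScalarTower.algebraMap_apply]
    exact h' (S'.algebraMap_mem c)
  let Oalg : Subalgebra k L := { OL.toSubring with algebraMap_mem' := hOLk }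
  -- `R` seen inside `L`
  set RL : Subalgebra k L := R.comap L.val with hRL
  have hRrange : R ≤ L.val.range := fun x hx => ⟨⟨x, (hmemL x).mpr (hRconst x hx)⟩, rfl⟩
  have hRLmap : RL.map L.val = R := by
    rw [hRL, Subalgebra.map_comap_eq]
    exact inf_eq_left.mpr hRrange
  have hRLfg : RL.FG :=
    Subalgebra.fg_of_fg_map _ L.val (by exact hfinj) (by rw [hRLmap]; exact hRfg)
  have hRLO : RL ≤ Oalg := fun x hx => h' (hRle (show L.val x ∈ R from hx))
  -- an affine model of `L` inside `O ∩ L`, joined with `R`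
  obtain ⟨A₀, hA₀O, hA₀fg, hA₀fr⟩ := exists_affineModel k L hLtop OL hOLk
  obtain ⟨tR, htR⟩ := hRLfg
  obtain ⟨tA, htA⟩ := hA₀fg
  set R' : Subalgebra k L := Algebra.adjoin k ((tR : Set L) ∪ (tA : Set L)) with hR'
  have hRLR' : RL ≤ R' := by
    rw [← htR]
    exact Algebra.adjoin_mono Set.subset_union_left
  have hA₀R' : A₀ ≤ R' := by
    rw [← htA]
    exact Algebra.adjoin_mono Set.subset_union_right
  have hR'fg : R'.FG := ⟨tR ∪ tA, by rw [Finset.coe_union]⟩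
  have hR'O : R' ≤ Oalg := by
    rw [hR']
    refine Algebra.adjoin_le ?_
    rintro x (hx | hx)
    · exact hRLO (htR ▸ Algebra.subset_adjoin hx : x ∈ RL)
    · exact hA₀O (htA ▸ Algebra.subset_adjoin hx : x ∈ A₀)
  have hR'fr : IsFractionRing R' L := isFractionRing_of_le hA₀R' hA₀fr
  -- relative local uniformization of `O ∩ L` above `R'`
  obtain ⟨AL, hAL, hR'AL, hALfg, hALreg⟩ :=
    H L hLtop OL hOLk R' hR'fg hR'fr (fun x hx => hR'O hx)
  have hALfr : IsFractionRing AL L := isFractionRing_of_le hR'AL hR'fr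
  haveI := hALfr
  -- transport to `K`
  set A : Subalgebra k K := AL.map L.val with hA
  have hmem : ∀ z : K, z ∈ A ↔ ∃ a ∈ AL, f a = z := fun z => Subalgebra.mem_map
  have hAO : A.toSubring ≤ O.toSubring := by
    intro z hz
    obtain ⟨a, ha, rfl⟩ := (hmem z).mp hz
    exact hAL ha
  refine ⟨A, hAO, ?_, hALfg.map _, ?_, ?_, ?_⟩
  · -- `R ≤ A`
    intro x hx
    rw [← hRLmap] at hx
    obtain ⟨y, hy, rfl⟩ := Subalgebra.mem_map.mp hx
    exact Subalgebra.mem_map.mpr ⟨y, hR'AL (hRLR' hy), rfl⟩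
  · -- `A` consists of constants
    intro x hx
    obtain ⟨a, -, rfl⟩ := (hmem x).mp hx
    exact a.2
  · -- `Frac A = K^D`
    intro x hx
    obtain ⟨a, b, hb, hab⟩ := IsFractionRing.div_surjective (A := AL) (⟨x, hx⟩ : L)
    refine ⟨f (algebraMap AL L a), f (algebraMap AL L b), (hmem _).mpr ⟨_, a.2, rfl⟩,
      (hmem _).mpr ⟨_, b.2, rfl⟩, ?_, ?_⟩
    · intro h0
      rw [map_eq_zero] at h0
      exact nonZeroDivisors.ne_zero hb (Subtype.ext h0)
    · rw [← map_div₀, hab]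
      rfl
  · -- regularity at the centre: transport along `AL ≅ AL.map f`
    set S : Subring K := AL.toSubring.map f with hS_def
    have hS : S ≤ O.toSubring := by
      rintro z ⟨a, ha, rfl⟩
      exact hAL ha
    have e' : A.toSubring = S := by
      ext z
      rw [Subalgebra.mem_toSubring, hmem, Subring.mem_map]
      constructor
      · rintro ⟨a, ha, rfl⟩
        exact ⟨a, ha, rfl⟩
      · rintro ⟨a, ha, rfl⟩
        exact ⟨a, ha, rfl⟩
    refine isRegularLocalRing_centre_of_toSubring_eq O A hAO hS e' ?_
    let e : AL.toSubring ≃+* S := AL.toSubring.equivMapOfInjective f hfinj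
    set P : Ideal S := Ideal.comap (Subring.inclusion hS) (maximalIdeal O) with hP
    haveI hPp : P.IsPrime := Ideal.comap_isPrime _ _
    refine (isRegularLocalRing_localization_iff_of_ringEquiv e P).mpr ?_
    have hPe : P.comap (e : AL.toSubring →+* S) =
        Ideal.comap (Subring.inclusion hAL) (maximalIdeal (O.comap f)) := by
      ext a
      have h2 : Subring.inclusion hS (e a) = ⟨f a, hAL a.2⟩ :=
        Subtype.ext (Subring.coe_equivMapOfInjective_apply _ f hfinj a)
      have h3 : Subring.inclusion hAL a = ⟨(a : L), hAL a.2⟩ := rfl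
      simp only [Ideal.mem_comap, hP, RingHom.coe_coe]
      rw [h2, h3]
      exact (mk_mem_maximalIdeal_comap_iff O f (hAL a.2)).symm
    haveI : (P.comap (e : AL.toSubring →+* S)).IsPrime := Ideal.comap_isPrime _ _
    exact isRegularLocalRing_localization_atPrime_congr hPe.symm hALreg

/-! ## `S → C`: the summit, and plain relative LU over perfect fields, imply the crux -/

/-- **The summit implies the crux**: `ResolutionOfSingularities → LogCanQuotLU`
(resolution in characteristic `p` gives relative local uniformization of every function field
over every field of characteristic `p`, `ResolutionInChar.relLocalUniformization`; apply the
core transport to the constant field). [folklore] -/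
theorem logCanQuotLU_of_resolutionOfSingularities (h : _root_.ResolutionOfSingularities) :
    LogCanQuotLU := by
  intro p hp k K _ _ _ _ _ O S' h' D g R hS'fg hS'frac _hreg _hD _hpc _hg _hpres _hcase hRfg hRle
    hRconst
  exact logCanQuotLU_body_of_relLU hp k K
    (fun K' _ _ _ O' _ => (h p hp).relLocalUniformization k K' O')
    O S' h' D R hS'fg hS'frac hRfg hRle hRconst

/-- Relative local uniformization over PERFECT ground fields of characteristic `p` — verbatim
the hypothesis of the route's `PatchingRelPerfect p` (= the conclusion of
`TorsorToLurelPerfect p`). [folklore] -/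
def RelLUPerfectAt (p : ℕ) : Prop :=
  ∀ (k K : Type) [Field k] [CharP k p] [PerfectField k] [Field K] [Algebra k K],
    (⊤ : IntermediateField k K).FG → ∀ O : ValuationSubring K, (∀ c : k, algebraMap k K c ∈ O) →
    ∀ R : Subalgebra k K, R.FG → R.toSubring ≤ O.toSubring →
      ∃ (A : Subalgebra k K) (h : A.toSubring ≤ O.toSubring), R ≤ A ∧ A.FG ∧
        IsFractionRing A K ∧
        IsRegularLocalRing (Localization.AtPrime
          (Ideal.comap (Subring.inclusion h) (IsLocalRing.maximalIdeal O)))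

/-- **Relative LU over perfect fields implies the crux**: the foliation hypotheses of
`LogCanQuotLU` are idle for its truth. [folklore] -/
theorem logCanQuotLU_of_relLUPerfect (H : ∀ p : ℕ, p.Prime → RelLUPerfectAt p) :
    LogCanQuotLU := by
  intro p hp k K _ _ _ _ _ O S' h' D g R hS'fg hS'frac _hreg _hD _hpc _hg _hpres _hcase hRfg hRle
    hRconst
  refine logCanQuotLU_body_of_relLU hp k K (fun K' _ _ hK' O' hO' => ?_)
    O S' h' D R hS'fg hS'frac hRfg hRle hRconst
  intro R' hR'fg _hR'fr hR'O
  obtain ⟨A, hA, hle, hfg, -, hreg⟩ := H p hp k K' hK' O' hO' R' hR'fg hR'O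
  exact ⟨A, hA, hle, hfg, hreg⟩

/-- **In route vocabulary**: the route's TARGET `TorsorLUPerfect` together with its Temkin crux
`TorsorToLurelPerfect` already give the crux `LogCanQuotLU`. [folklore] -/
theorem logCanQuotLU_of_torsorLUPerfect_of_torsorToLurelPerfect (hT : TorsorLUPerfect)
    (hTT : TorsorToLurelPerfect) : LogCanQuotLU :=
  logCanQuotLU_of_relLUPerfect fun p hp => hTT p hp (hT p hp)

/-! ## §5 Load-bearing analysis (cdisprove cycle 1): the mutations, by name -/

section LoadBearing

/-- The crux with ONLY the hypothesis "`S'` is regular at the centre of `O`" deleted. -/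
def LogCanQuotLUWithoutRegularTop : Prop :=
  ∀ p : ℕ, p.Prime → ∀ (k K : Type) [Field k] [CharP k p] [PerfectField k] [Field K]
    [Algebra k K] (O : ValuationSubring K) (S' : Subalgebra k K) (_h' : S'.toSubring ≤ O.toSubring)
    (D : Derivation k K K) (g : K) (R : Subalgebra k K), S'.FG → IsFractionRing S' K →
    D ≠ 0 → (∃ c : K, ∀ x : K, (⇑D)^[p] x = c * D x) → g ≠ 0 →
    (∀ x : K, (∃ a b : K, a ∈ S' ∧ b ∈ S' ∧ b ≠ 0 ∧ b⁻¹ ∈ O ∧ x = a / b) →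
      ∃ a b : K, a ∈ S' ∧ b ∈ S' ∧ b ≠ 0 ∧ b⁻¹ ∈ O ∧ (g • D) x = a / b) →
    ((∃ x : K, (∃ a b : K, a ∈ S' ∧ b ∈ S' ∧ b ≠ 0 ∧ b⁻¹ ∈ O ∧ x = a / b) ∧ (g • D) x ≠ 0 ∧
        ((g • D) x)⁻¹ ∈ O) ∨
      (∃ u : K, (∃ a b : K, a ∈ S' ∧ b ∈ S' ∧ b ≠ 0 ∧ b⁻¹ ∈ O ∧ u = a / b) ∧ u ≠ 0 ∧ u⁻¹ ∈ O ∧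
        ∀ x : K, (⇑(g • D))^[p] x = u * (g • D) x)) →
    R.FG → R ≤ S' → (∀ x ∈ R, D x = 0) →
    ∃ (A : Subalgebra k K) (hA : A.toSubring ≤ O.toSubring), R ≤ A ∧ A.FG ∧ (∀ x ∈ A, D x = 0) ∧
      (∀ x : K, D x = 0 → ∃ a b : K, a ∈ A ∧ b ∈ A ∧ b ≠ 0 ∧ x = a / b) ∧
      IsRegularLocalRing
        (Localization.AtPrime (Ideal.comap (Subring.inclusion hA) (IsLocalRing.maximalIdeal O)))

/-- The crux with ONLY the hypothesis `g ≠ 0` deleted. -/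
def LogCanQuotLUWithoutGNeZero : Prop :=
  ∀ p : ℕ, p.Prime → ∀ (k K : Type) [Field k] [CharP k p] [PerfectField k] [Field K]
    [Algebra k K] (O : ValuationSubring K) (S' : Subalgebra k K) (h' : S'.toSubring ≤ O.toSubring)
    (D : Derivation k K K) (g : K) (R : Subalgebra k K), S'.FG → IsFractionRing S' K →
    IsRegularLocalRing
      (Localization.AtPrime (Ideal.comap (Subring.inclusion h') (IsLocalRing.maximalIdeal O))) →
    D ≠ 0 → (∃ c : K, ∀ x : K, (⇑D)^[p] x = c * D x) →
    (∀ x : K, (∃ a b : K, a ∈ S' ∧ b ∈ S' ∧ b ≠ 0 ∧ b⁻¹ ∈ O ∧ x = a / b) →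
      ∃ a b : K, a ∈ S' ∧ b ∈ S' ∧ b ≠ 0 ∧ b⁻¹ ∈ O ∧ (g • D) x = a / b) →
    ((∃ x : K, (∃ a b : K, a ∈ S' ∧ b ∈ S' ∧ b ≠ 0 ∧ b⁻¹ ∈ O ∧ x = a / b) ∧ (g • D) x ≠ 0 ∧
        ((g • D) x)⁻¹ ∈ O) ∨
      (∃ u : K, (∃ a b : K, a ∈ S' ∧ b ∈ S' ∧ b ≠ 0 ∧ b⁻¹ ∈ O ∧ u = a / b) ∧ u ≠ 0 ∧ u⁻¹ ∈ O ∧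
        ∀ x : K, (⇑(g • D))^[p] x = u * (g • D) x)) →
    R.FG → R ≤ S' → (∀ x ∈ R, D x = 0) →
    ∃ (A : Subalgebra k K) (hA : A.toSubring ≤ O.toSubring), R ≤ A ∧ A.FG ∧ (∀ x ∈ A, D x = 0) ∧
      (∀ x : K, D x = 0 → ∃ a b : K, a ∈ A ∧ b ∈ A ∧ b ≠ 0 ∧ x = a / b) ∧
      IsRegularLocalRing
        (Localization.AtPrime (Ideal.comap (Subring.inclusion hA) (IsLocalRing.maximalIdeal O)))

/-- The crux with ONLY the hypothesis `D ≠ 0` deleted. -/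
def LogCanQuotLUWithoutDNeZero : Prop :=
  ∀ p : ℕ, p.Prime → ∀ (k K : Type) [Field k] [CharP k p] [PerfectField k] [Field K]
    [Algebra k K] (O : ValuationSubring K) (S' : Subalgebra k K) (h' : S'.toSubring ≤ O.toSubring)
    (D : Derivation k K K) (g : K) (R : Subalgebra k K), S'.FG → IsFractionRing S' K →
    IsRegularLocalRing
      (Localization.AtPrime (Ideal.comap (Subring.inclusion h') (IsLocalRing.maximalIdeal O))) →
    (∃ c : K, ∀ x : K, (⇑D)^[p] x = c * D x) → g ≠ 0 →
    (∀ x : K, (∃ a b : K, a ∈ S' ∧ b ∈ S' ∧ b ≠ 0 ∧ b⁻¹ ∈ O ∧ x = a / b) →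
      ∃ a b : K, a ∈ S' ∧ b ∈ S' ∧ b ≠ 0 ∧ b⁻¹ ∈ O ∧ (g • D) x = a / b) →
    ((∃ x : K, (∃ a b : K, a ∈ S' ∧ b ∈ S' ∧ b ≠ 0 ∧ b⁻¹ ∈ O ∧ x = a / b) ∧ (g • D) x ≠ 0 ∧
        ((g • D) x)⁻¹ ∈ O) ∨
      (∃ u : K, (∃ a b : K, a ∈ S' ∧ b ∈ S' ∧ b ≠ 0 ∧ b⁻¹ ∈ O ∧ u = a / b) ∧ u ≠ 0 ∧ u⁻¹ ∈ O ∧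
        ∀ x : K, (⇑(g • D))^[p] x = u * (g • D) x)) →
    R.FG → R ≤ S' → (∀ x ∈ R, D x = 0) →
    ∃ (A : Subalgebra k K) (hA : A.toSubring ≤ O.toSubring), R ≤ A ∧ A.FG ∧ (∀ x ∈ A, D x = 0) ∧
      (∀ x : K, D x = 0 → ∃ a b : K, a ∈ A ∧ b ∈ A ∧ b ≠ 0 ∧ x = a / b) ∧
      IsRegularLocalRing
        (Localization.AtPrime (Ideal.comap (Subring.inclusion hA) (IsLocalRing.maximalIdeal O)))

/-- Each mutation is a strengthening of the crux (a hypothesis is deleted). -/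
theorem logCanQuotLU_of_withoutRegularTop (h : LogCanQuotLUWithoutRegularTop) : LogCanQuotLU :=
  fun p hp k K _ _ _ _ _ O S' h' D g R hfg hfr _ hD hpc hg hpres hcase hRfg hRle hRconst =>
    h p hp k K O S' h' D g R hfg hfr hD hpc hg hpres hcase hRfg hRle hRconst

theorem logCanQuotLU_of_withoutGNeZero (h : LogCanQuotLUWithoutGNeZero) : LogCanQuotLU :=
  fun p hp k K _ _ _ _ _ O S' h' D g R hfg hfr hreg hD hpc _ hpres hcase hRfg hRle hRconst =>
    h p hp k K O S' h' D g R hfg hfr hreg hD hpc hpres hcase hRfg hRle hRconst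

/-- **`D ≠ 0` is idle**: deleting it does not change the crux (at `D = 0` take `A := S'`,
landed as `Negative.logCanQuotLU_body_of_derivation_zero`). [folklore] -/
theorem withoutDNeZero_iff : LogCanQuotLUWithoutDNeZero ↔ LogCanQuotLU := by
  constructor
  · intro h p hp k K _ _ _ _ _ O S' h' D g R hfg hfr hreg _ hpc hg hpres hcase hRfg hRle hRconst
    exact h p hp k K O S' h' D g R hfg hfr hreg hpc hg hpres hcase hRfg hRle hRconst
  · intro h p hp k K _ _ _ _ _ O S' h' D g R hfg hfr hreg hpc hg hpres hcase hRfg hRle hRconst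
    by_cases hD : D = 0
    · subst hD
      exact Theorems.LogCanQuotLU.Negative.logCanQuotLU_body_of_derivation_zero k K O S' h' R hfg
        hfr hreg hRle
    · exact h p hp k K O S' h' D g R hfg hfr hreg hD hpc hg hpres hcase hRfg hRle hRconst

/-- **"`S'` regular at the centre" carries the whole gap**: the crux without it is EQUIVALENT to
relative local uniformization over perfect fields (the antecedent of the route's
`PatchingRelPerfect p`, for every `p`). (→: landed `Negative.relLU_perfect_of_logCanQuotLU_withoutRegularTop`;
←: the core transport `logCanQuotLU_body_of_relLU` of §2, which never used regularity.)
[folklore] -/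
theorem withoutRegularTop_iff_relLUPerfect :
    LogCanQuotLUWithoutRegularTop ↔ ∀ p : ℕ, p.Prime → RelLUPerfectAt p := by
  constructor
  · intro h p hp k K _ _ _ _ _ hK O hO R hRfg hRO
    exact Theorems.LogCanQuotLU.Negative.relLU_perfect_of_logCanQuotLU_withoutRegularTop h p hp k K
      hK O hO R hRfg hRO
  · intro H p hp k K _ _ _ _ _ O S' h' D g R hS'fg hS'frac _hD _hpc _hg _hpres _hcase hRfg hRle
      hRconst
    refine logCanQuotLU_body_of_relLU hp k K (fun K' _ _ hK' O' hO' => ?_)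
      O S' h' D R hS'fg hS'frac hRfg hRle hRconst
    intro R' hR'fg _hR'fr hR'O
    obtain ⟨A, hA, hle, hfg, -, hreg⟩ := H p hp k K' hK' O' hO' R' hR'fg hR'O
    exact ⟨A, hA, hle, hfg, hreg⟩

/-- Hence the crux without the regular top would, together with the route's two patching /
descent items, already close the summit — bypassing `FolLU`, `DualSandwich`, `TorsorLUPerfect`
and `TorsorToLurelPerfect`. [folklore] -/
theorem resolutionOfSingularities_of_withoutRegularTop_patching_descent
    (h : LogCanQuotLUWithoutRegularTop) (hP : PatchingRelPerfect) (hD : DescentPerfectToAll) :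
    _root_.ResolutionOfSingularities :=
  fun p hp => hD p hp (hP p hp (withoutRegularTop_iff_relLUPerfect.mp h p hp))

/-- Contrapositive, for the record: a counterexample to relative LU over some perfect field of
characteristic `p` is exactly what it takes to refute the crux-without-regular-top. -/
theorem not_withoutRegularTop_of_not_relLUPerfect {p : ℕ} (hp : p.Prime)
    (h : ¬ RelLUPerfectAt p) : ¬ LogCanQuotLUWithoutRegularTop :=
  fun hW => h (withoutRegularTop_iff_relLUPerfect.mp hW p hp)

/-- **"`g ≠ 0`" is load-bearing**: without it the crux gives RRLU1 over perfect fields with no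
foliation input (landed `Negative.rrLU1_perfect_of_logCanQuotLU_withoutGNeZero`), hence — with
Temkin's inseparable local uniformization — LU of every finitely generated extension of every
perfect field of characteristic `p`. [cite: Temkin2013, Thm. 1.3.2] -/
theorem isLocallyUniformizable_perfect_of_temkin2013_withoutGNeZero (hT : Temkin2013.{0})
    (h : LogCanQuotLUWithoutGNeZero) {p : ℕ} [Fact p.Prime] (k : Type) [Field k] [CharP k p]
    [PerfectField k] (K : Type) [Field K] [Algebra k K] (hfg : (⊤ : IntermediateField k K).FG)
    (O : ValuationSubring K) (hO : ∀ c : k, algebraMap k K c ∈ O) :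
    IsLocallyUniformizable k K O :=
  Theorems.LogCanQuotLU.Negative.isLocallyUniformizable_perfect_of_temkin2013_of_logCanQuotLU_withoutGNeZero
    h hT k K hfg O hO

/-- The crux with ONLY the dichotomy "non-singular ∨ multiplicative" deleted (`g ≠ 0` and the
preservation of `S'_c` kept). -/
def LogCanQuotLUWithoutDichotomy : Prop :=
  ∀ p : ℕ, p.Prime → ∀ (k K : Type) [Field k] [CharP k p] [PerfectField k] [Field K]
    [Algebra k K] (O : ValuationSubring K) (S' : Subalgebra k K) (h' : S'.toSubring ≤ O.toSubring)
    (D : Derivation k K K) (g : K) (R : Subalgebra k K), S'.FG → IsFractionRing S' K →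
    IsRegularLocalRing
      (Localization.AtPrime (Ideal.comap (Subring.inclusion h') (IsLocalRing.maximalIdeal O))) →
    D ≠ 0 → (∃ c : K, ∀ x : K, (⇑D)^[p] x = c * D x) → g ≠ 0 →
    (∀ x : K, (∃ a b : K, a ∈ S' ∧ b ∈ S' ∧ b ≠ 0 ∧ b⁻¹ ∈ O ∧ x = a / b) →
      ∃ a b : K, a ∈ S' ∧ b ∈ S' ∧ b ≠ 0 ∧ b⁻¹ ∈ O ∧ (g • D) x = a / b) →
    R.FG → R ≤ S' → (∀ x ∈ R, D x = 0) →
    ∃ (A : Subalgebra k K) (hA : A.toSubring ≤ O.toSubring), R ≤ A ∧ A.FG ∧ (∀ x ∈ A, D x = 0) ∧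
      (∀ x : K, D x = 0 → ∃ a b : K, a ∈ A ∧ b ∈ A ∧ b ≠ 0 ∧ x = a / b) ∧
      IsRegularLocalRing
        (Localization.AtPrime (Ideal.comap (Subring.inclusion hA) (IsLocalRing.maximalIdeal O)))

theorem logCanQuotLU_of_withoutDichotomy (h : LogCanQuotLUWithoutDichotomy) : LogCanQuotLU :=
  fun p hp k K _ _ _ _ _ O S' h' D g R hfg hfr hreg hD hpc hg hpres _ hRfg hRle hRconst =>
    h p hp k K O S' h' D g R hfg hfr hreg hD hpc hg hpres hRfg hRle hRconst

/-- **The dichotomy is the load-bearing part of "log-canonical"**: with `g ≠ 0` and preservation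
kept but "non-singular ∨ multiplicative" deleted, the crux still gives (with `Temkin2013`) local
uniformization over every perfect field (landed
`Negative.rrLU1_perfect_of_logCanQuotLU_withoutDichotomy`). [cite: Temkin2013, Thm. 1.3.2] -/
theorem isLocallyUniformizable_perfect_of_temkin2013_withoutDichotomy (hT : Temkin2013.{0})
    (h : LogCanQuotLUWithoutDichotomy) {p : ℕ} [Fact p.Prime] (k : Type) [Field k] [CharP k p]
    [PerfectField k] (K : Type) [Field K] [Algebra k K] (hfg : (⊤ : IntermediateField k K).FG)
    (O : ValuationSubring K) (hO : ∀ c : k, algebraMap k K c ∈ O) :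
    IsLocallyUniformizable k K O :=
  Theorems.LogCanQuotLU.Negative.isLocallyUniformizable_perfect_of_temkin2013_of_logCanQuotLU_withoutDichotomy
    h hT k K hfg O hO

/-- The crux with ONLY the hypothesis `S'.FG` deleted. -/
def LogCanQuotLUWithoutFG : Prop :=
  ∀ p : ℕ, p.Prime → ∀ (k K : Type) [Field k] [CharP k p] [PerfectField k] [Field K]
    [Algebra k K] (O : ValuationSubring K) (S' : Subalgebra k K)
    (h' : S'.toSubring ≤ O.toSubring) (D : Derivation k K K) (g : K) (R : Subalgebra k K),
    IsFractionRing S' K →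
    IsRegularLocalRing (Localization.AtPrime
      (Ideal.comap (Subring.inclusion h') (IsLocalRing.maximalIdeal O))) →
    D ≠ 0 → (∃ c : K, ∀ x : K, (⇑D)^[p] x = c * D x) → g ≠ 0 →
    (∀ x : K, (∃ a b : K, a ∈ S' ∧ b ∈ S' ∧ b ≠ 0 ∧ b⁻¹ ∈ O ∧ x = a / b) →
      ∃ a b : K, a ∈ S' ∧ b ∈ S' ∧ b ≠ 0 ∧ b⁻¹ ∈ O ∧ (g • D) x = a / b) →
    ((∃ x : K, (∃ a b : K, a ∈ S' ∧ b ∈ S' ∧ b ≠ 0 ∧ b⁻¹ ∈ O ∧ x = a / b) ∧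
        (g • D) x ≠ 0 ∧ ((g • D) x)⁻¹ ∈ O) ∨
      (∃ u : K, (∃ a b : K, a ∈ S' ∧ b ∈ S' ∧ b ≠ 0 ∧ b⁻¹ ∈ O ∧ u = a / b) ∧ u ≠ 0 ∧
        u⁻¹ ∈ O ∧ ∀ x : K, (⇑(g • D))^[p] x = u * (g • D) x)) →
    R.FG → R ≤ S' → (∀ x ∈ R, D x = 0) →
    ∃ (A : Subalgebra k K) (hA : A.toSubring ≤ O.toSubring), R ≤ A ∧ A.FG ∧
      (∀ x ∈ A, D x = 0) ∧
      (∀ x : K, D x = 0 → ∃ a b : K, a ∈ A ∧ b ∈ A ∧ b ≠ 0 ∧ x = a / b) ∧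
      IsRegularLocalRing (Localization.AtPrime
        (Ideal.comap (Subring.inclusion hA) (IsLocalRing.maximalIdeal O)))

theorem logCanQuotLU_of_withoutFG (h : LogCanQuotLUWithoutFG) : LogCanQuotLU :=
  fun p hp k K _ _ _ _ _ O S' h' D g R _ hfr hreg hD hpc hg hpres hcase hRfg hRle hRconst =>
    h p hp k K O S' h' D g R hfr hreg hD hpc hg hpres hcase hRfg hRle hRconst

/-- **`S'.FG` is load-bearing for TRUTH**: the crux with only the finite generation of `S'`
deleted is FALSE (landed `Negative.logCanQuotLU_false_without_fg`: `K = 𝔽₂(X₀, X₁, …)`,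
`S' = O = K`, `D = ∂/∂X₀`). [folklore] -/
theorem not_withoutFG : ¬ LogCanQuotLUWithoutFG :=
  Theorems.LogCanQuotLU.Negative.logCanQuotLU_false_without_fg

/-- The crux with ONLY the hypothesis `IsFractionRing S' K` deleted. -/
def LogCanQuotLUWithoutIsFractionRing : Prop :=
  ∀ p : ℕ, p.Prime → ∀ (k K : Type) [Field k] [CharP k p] [PerfectField k] [Field K]
    [Algebra k K] (O : ValuationSubring K) (S' : Subalgebra k K)
    (h' : S'.toSubring ≤ O.toSubring) (D : Derivation k K K) (g : K) (R : Subalgebra k K),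
    S'.FG →
    IsRegularLocalRing (Localization.AtPrime
      (Ideal.comap (Subring.inclusion h') (IsLocalRing.maximalIdeal O))) →
    D ≠ 0 → (∃ c : K, ∀ x : K, (⇑D)^[p] x = c * D x) → g ≠ 0 →
    (∀ x : K, (∃ a b : K, a ∈ S' ∧ b ∈ S' ∧ b ≠ 0 ∧ b⁻¹ ∈ O ∧ x = a / b) →
      ∃ a b : K, a ∈ S' ∧ b ∈ S' ∧ b ≠ 0 ∧ b⁻¹ ∈ O ∧ (g • D) x = a / b) →
    ((∃ x : K, (∃ a b : K, a ∈ S' ∧ b ∈ S' ∧ b ≠ 0 ∧ b⁻¹ ∈ O ∧ x = a / b) ∧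
        (g • D) x ≠ 0 ∧ ((g • D) x)⁻¹ ∈ O) ∨
      (∃ u : K, (∃ a b : K, a ∈ S' ∧ b ∈ S' ∧ b ≠ 0 ∧ b⁻¹ ∈ O ∧ u = a / b) ∧ u ≠ 0 ∧
        u⁻¹ ∈ O ∧ ∀ x : K, (⇑(g • D))^[p] x = u * (g • D) x)) →
    R.FG → R ≤ S' → (∀ x ∈ R, D x = 0) →
    ∃ (A : Subalgebra k K) (hA : A.toSubring ≤ O.toSubring), R ≤ A ∧ A.FG ∧
      (∀ x ∈ A, D x = 0) ∧
      (∀ x : K, D x = 0 → ∃ a b : K, a ∈ A ∧ b ∈ A ∧ b ≠ 0 ∧ x = a / b) ∧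
      IsRegularLocalRing (Localization.AtPrime
        (Ideal.comap (Subring.inclusion hA) (IsLocalRing.maximalIdeal O)))

theorem logCanQuotLU_of_withoutIsFractionRing (h : LogCanQuotLUWithoutIsFractionRing) :
    LogCanQuotLU :=
  fun p hp k K _ _ _ _ _ O S' h' D g R hfg _ hreg hD hpc hg hpres hcase hRfg hRle hRconst =>
    h p hp k K O S' h' D g R hfg hreg hD hpc hg hpres hcase hRfg hRle hRconst

/-- **`IsFractionRing S' K` is load-bearing for TRUTH**: the crux with only `Frac S' = K` deleted
is FALSE (landed `Negative.logCanQuotLU_false_without_isFractionRing`, p155141: `S' = k[X₀] ⊆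
K = 𝔽₂(X₀, X₁, …)`). [folklore] -/
theorem not_withoutIsFractionRing : ¬ LogCanQuotLUWithoutIsFractionRing :=
  Theorems.LogCanQuotLU.Negative.logCanQuotLU_false_without_isFractionRing

/-! ## §6 cdisprove gen 2: `R`-constancy, non-vacuity, A₁ tightness, the twist (re-exports) -/

/-- The crux with ONLY the hypothesis "`D x = 0` for `x ∈ R`" deleted. -/
def LogCanQuotLUWithoutRConst : Prop :=
  ∀ p : ℕ, p.Prime → ∀ (k K : Type) [Field k] [CharP k p] [PerfectField k] [Field K]
    [Algebra k K] (O : ValuationSubring K) (S' : Subalgebra k K)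
    (h' : S'.toSubring ≤ O.toSubring) (D : Derivation k K K) (g : K) (R : Subalgebra k K),
    S'.FG → IsFractionRing S' K →
    IsRegularLocalRing (Localization.AtPrime
      (Ideal.comap (Subring.inclusion h') (IsLocalRing.maximalIdeal O))) →
    D ≠ 0 → (∃ c : K, ∀ x : K, (⇑D)^[p] x = c * D x) → g ≠ 0 →
    (∀ x : K, (∃ a b : K, a ∈ S' ∧ b ∈ S' ∧ b ≠ 0 ∧ b⁻¹ ∈ O ∧ x = a / b) →
      ∃ a b : K, a ∈ S' ∧ b ∈ S' ∧ b ≠ 0 ∧ b⁻¹ ∈ O ∧ (g • D) x = a / b) →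
    ((∃ x : K, (∃ a b : K, a ∈ S' ∧ b ∈ S' ∧ b ≠ 0 ∧ b⁻¹ ∈ O ∧ x = a / b) ∧
        (g • D) x ≠ 0 ∧ ((g • D) x)⁻¹ ∈ O) ∨
      (∃ u : K, (∃ a b : K, a ∈ S' ∧ b ∈ S' ∧ b ≠ 0 ∧ b⁻¹ ∈ O ∧ u = a / b) ∧ u ≠ 0 ∧
        u⁻¹ ∈ O ∧ ∀ x : K, (⇑(g • D))^[p] x = u * (g • D) x)) →
    R.FG → R ≤ S' →
    ∃ (A : Subalgebra k K) (hA : A.toSubring ≤ O.toSubring), R ≤ A ∧ A.FG ∧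
      (∀ x ∈ A, D x = 0) ∧
      (∀ x : K, D x = 0 → ∃ a b : K, a ∈ A ∧ b ∈ A ∧ b ≠ 0 ∧ x = a / b) ∧
      IsRegularLocalRing (Localization.AtPrime
        (Ideal.comap (Subring.inclusion hA) (IsLocalRing.maximalIdeal O)))

theorem logCanQuotLU_of_withoutRConst (h : LogCanQuotLUWithoutRConst) : LogCanQuotLU :=
  fun p hp k K _ _ _ _ _ O S' h' D g R hfg hfr hreg hD hpc hg hpres hcase hRfg hRle _ =>
    h p hp k K O S' h' D g R hfg hfr hreg hD hpc hg hpres hcase hRfg hRle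

/-- **`R`-constancy is load-bearing for TRUTH** (landed
`Negative.logCanQuotLU_false_without_RConst`, p162934: `R := S' ∋ X₀`, `D X₀ = 1`). [folklore] -/
theorem not_withoutRConst : ¬ LogCanQuotLUWithoutRConst :=
  Theorems.LogCanQuotLU.Negative.logCanQuotLU_false_without_RConst

/-- "The hypotheses of the crux are contradictory in the non-singular branch over a non-trivial
valuation ring" — FALSE, i.e. the crux is NOT vacuously true there. -/
def LogCanQuotLUHypsContradictoryNonsingular : Prop :=
  ∀ p : ℕ, p.Prime → ∀ (k K : Type) [Field k] [CharP k p] [PerfectField k] [Field K]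
    [Algebra k K] (O : ValuationSubring K) (S' : Subalgebra k K)
    (h' : S'.toSubring ≤ O.toSubring) (D : Derivation k K K) (g : K) (R : Subalgebra k K),
    S'.FG → IsFractionRing S' K →
    IsRegularLocalRing (Localization.AtPrime
      (Ideal.comap (Subring.inclusion h') (IsLocalRing.maximalIdeal O))) →
    D ≠ 0 → (∃ c : K, ∀ x : K, (⇑D)^[p] x = c * D x) → g ≠ 0 →
    (∀ x : K, (∃ a b : K, a ∈ S' ∧ b ∈ S' ∧ b ≠ 0 ∧ b⁻¹ ∈ O ∧ x = a / b) →
      ∃ a b : K, a ∈ S' ∧ b ∈ S' ∧ b ≠ 0 ∧ b⁻¹ ∈ O ∧ (g • D) x = a / b) →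
    ((∃ x : K, (∃ a b : K, a ∈ S' ∧ b ∈ S' ∧ b ≠ 0 ∧ b⁻¹ ∈ O ∧ x = a / b) ∧
        (g • D) x ≠ 0 ∧ ((g • D) x)⁻¹ ∈ O) ∨
      (∃ u : K, (∃ a b : K, a ∈ S' ∧ b ∈ S' ∧ b ≠ 0 ∧ b⁻¹ ∈ O ∧ u = a / b) ∧ u ≠ 0 ∧
        u⁻¹ ∈ O ∧ ∀ x : K, (⇑(g • D))^[p] x = u * (g • D) x)) →
    R.FG → R ≤ S' → (∀ x ∈ R, D x = 0) →
    (∃ x : K, (∃ a b : K, a ∈ S' ∧ b ∈ S' ∧ b ≠ 0 ∧ b⁻¹ ∈ O ∧ x = a / b) ∧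
        (g • D) x ≠ 0 ∧ ((g • D) x)⁻¹ ∈ O) →
    (∃ x : K, x ∉ O) → False

/-- **Non-vacuity, non-singular branch** (landed
`Negative.logCanQuotLU_hypotheses_inhabited_nonsingular`, p162934: `p = 2`, `∂/∂X₀` on
`𝔽₂(X₀, X₁)`, `O` dominating the origin, `g = 1`, `R = 𝔽₂`). [folklore] -/
theorem not_hypsContradictory_nonsingular : ¬ LogCanQuotLUHypsContradictoryNonsingular :=
  Theorems.LogCanQuotLU.Negative.logCanQuotLU_hypotheses_inhabited_nonsingular

/-- "The hypotheses of the crux are contradictory in the SINGULAR MULTIPLICATIVE regime over a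
non-trivial valuation ring" — FALSE: the regime in which stub 3 of line `birth` has content is
inhabited (with all finiteness clauses). -/
def LogCanQuotLUHypsContradictorySingularMultiplicative : Prop :=
  ∀ p : ℕ, p.Prime → ∀ (k K : Type) [Field k] [CharP k p] [PerfectField k] [Field K]
    [Algebra k K] (O : ValuationSubring K) (S' : Subalgebra k K)
    (h' : S'.toSubring ≤ O.toSubring) (D : Derivation k K K) (g : K) (R : Subalgebra k K),
    S'.FG → IsFractionRing S' K →
    IsRegularLocalRing (Localization.AtPrime
      (Ideal.comap (Subring.inclusion h') (IsLocalRing.maximalIdeal O))) →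
    D ≠ 0 → (∃ c : K, ∀ x : K, (⇑D)^[p] x = c * D x) → g ≠ 0 →
    (∀ x : K, (∃ a b : K, a ∈ S' ∧ b ∈ S' ∧ b ≠ 0 ∧ b⁻¹ ∈ O ∧ x = a / b) →
      ∃ a b : K, a ∈ S' ∧ b ∈ S' ∧ b ≠ 0 ∧ b⁻¹ ∈ O ∧ (g • D) x = a / b) →
    ((∃ x : K, (∃ a b : K, a ∈ S' ∧ b ∈ S' ∧ b ≠ 0 ∧ b⁻¹ ∈ O ∧ x = a / b) ∧
        (g • D) x ≠ 0 ∧ ((g • D) x)⁻¹ ∈ O) ∨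
      (∃ u : K, (∃ a b : K, a ∈ S' ∧ b ∈ S' ∧ b ≠ 0 ∧ b⁻¹ ∈ O ∧ u = a / b) ∧ u ≠ 0 ∧
        u⁻¹ ∈ O ∧ ∀ x : K, (⇑(g • D))^[p] x = u * (g • D) x)) →
    R.FG → R ≤ S' → (∀ x ∈ R, D x = 0) →
    (∃ u : K, (∃ a b : K, a ∈ S' ∧ b ∈ S' ∧ b ≠ 0 ∧ b⁻¹ ∈ O ∧ u = a / b) ∧ u ≠ 0 ∧
        u⁻¹ ∈ O ∧ ∀ x : K, (⇑(g • D))^[p] x = u * (g • D) x) →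
    (∀ x : K, (∃ a b : K, a ∈ S' ∧ b ∈ S' ∧ b ≠ 0 ∧ b⁻¹ ∈ O ∧ x = a / b) →
        (g • D) x ≠ 0 → ((g • D) x)⁻¹ ∉ O) →
    (∃ x : K, x ∉ O) → False

/-- **Non-vacuity, singular multiplicative regime** (landed
`Negative.logCanQuotLU_hypotheses_inhabited_singular_multiplicative`, p162934: `p = 2`, Euler
field `X₀∂₀ + X₁∂₁` on `𝔽₂(X₀, X₁)`, `E ∘ E = E`, `u = 1`, every value on `S'_c` a non-unit).
[folklore] -/
theorem not_hypsContradictory_singularMultiplicative :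
    ¬ LogCanQuotLUHypsContradictorySingularMultiplicative :=
  Theorems.LogCanQuotLU.Negative.logCanQuotLU_hypotheses_inhabited_singular_multiplicative

/-- The natural strengthening "`A := S'^D` is regular at the centre ALSO in the multiplicative case"
(= `Sig.stub_nonsingularDescent` of line `birth` with its non-singular clause replaced by the
multiplicative clause, `[PerfectField k]` added). -/
def LogCanQuotLUConstantsRegularMult : Prop :=
  ∀ p : ℕ, p.Prime → ∀ (k K : Type) [Field k] [CharP k p] [PerfectField k] [Field K]
    [Algebra k K] (O : ValuationSubring K) (S' : Subalgebra k K)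
    (h' : S'.toSubring ≤ O.toSubring) (D : Derivation k K K) (g : K) (A : Subalgebra k K)
    (hA : A.toSubring ≤ O.toSubring),
    S'.FG → IsFractionRing S' K →
    IsRegularLocalRing (Localization.AtPrime
      (Ideal.comap (Subring.inclusion h') (IsLocalRing.maximalIdeal O))) →
    D ≠ 0 → (∃ c : K, ∀ x : K, (⇑D)^[p] x = c * D x) → g ≠ 0 →
    (∀ x : K, (∃ a b : K, a ∈ S' ∧ b ∈ S' ∧ b ≠ 0 ∧ b⁻¹ ∈ O ∧ x = a / b) →
      ∃ a b : K, a ∈ S' ∧ b ∈ S' ∧ b ≠ 0 ∧ b⁻¹ ∈ O ∧ (g • D) x = a / b) →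
    (∃ u : K, (∃ a b : K, a ∈ S' ∧ b ∈ S' ∧ b ≠ 0 ∧ b⁻¹ ∈ O ∧ u = a / b) ∧ u ≠ 0 ∧
      u⁻¹ ∈ O ∧ ∀ x : K, (⇑(g • D))^[p] x = u * (g • D) x) →
    (∀ x : K, x ∈ A ↔ (x ∈ S' ∧ D x = 0)) →
    IsRegularLocalRing (Localization.AtPrime
      (Ideal.comap (Subring.inclusion hA) (IsLocalRing.maximalIdeal O)))

/-- **TIGHTNESS (A₁): in the multiplicative case the constants are NOT regular at the centre**
(landed `Negative.isRegularLocalRing_constants_false_multiplicative`, p163011: `p = 2`, Euler field,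
`𝔽₂[X₀², X₀X₁, X₁²]`; `X₀² ∈ 𝔪 ∖ 𝔪²` not prime in `A_𝔭`, against Matsumura 14.3).
[cite: RudakovShafarevich1976, §2] -/
theorem not_constantsRegularMult : ¬ LogCanQuotLUConstantsRegularMult :=
  Theorems.LogCanQuotLU.Negative.isRegularLocalRing_constants_false_multiplicative

/-- The natural strengthening of the multiplicative case "some UNIT `h` of `S'_c` rescales `g•D`
to an idempotent derivation, `((hg)•D)^p = (hg)•D`" (the twisted form `G_u` of `μ_p` splits
Zariski-locally), stated even at singular multiplicative points. -/
def LogCanQuotLUMultUnitNormalisation : Prop :=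
  ∀ p : ℕ, p.Prime → ∀ (k K : Type) [Field k] [CharP k p] [PerfectField k] [Field K]
    [Algebra k K] (O : ValuationSubring K) (S' : Subalgebra k K)
    (h' : S'.toSubring ≤ O.toSubring) (D : Derivation k K K) (g : K),
    S'.FG → IsFractionRing S' K →
    IsRegularLocalRing (Localization.AtPrime
      (Ideal.comap (Subring.inclusion h') (IsLocalRing.maximalIdeal O))) →
    D ≠ 0 → (∃ c : K, ∀ x : K, (⇑D)^[p] x = c * D x) → g ≠ 0 →
    (∀ x : K, (∃ a b : K, a ∈ S' ∧ b ∈ S' ∧ b ≠ 0 ∧ b⁻¹ ∈ O ∧ x = a / b) →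
      ∃ a b : K, a ∈ S' ∧ b ∈ S' ∧ b ≠ 0 ∧ b⁻¹ ∈ O ∧ (g • D) x = a / b) →
    (∃ u : K, (∃ a b : K, a ∈ S' ∧ b ∈ S' ∧ b ≠ 0 ∧ b⁻¹ ∈ O ∧ u = a / b) ∧ u ≠ 0 ∧
      u⁻¹ ∈ O ∧ ∀ x : K, (⇑(g • D))^[p] x = u * (g • D) x) →
    (∀ x : K, (∃ a b : K, a ∈ S' ∧ b ∈ S' ∧ b ≠ 0 ∧ b⁻¹ ∈ O ∧ x = a / b) →
        (g • D) x ≠ 0 → ((g • D) x)⁻¹ ∉ O) →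
    ∃ h : K, (∃ a b : K, a ∈ S' ∧ b ∈ S' ∧ b ≠ 0 ∧ b⁻¹ ∈ O ∧ h = a / b) ∧ h ≠ 0 ∧
      h⁻¹ ∈ O ∧ ∀ x : K, (⇑((h * g) • D))^[p] x = ((h * g) • D) x

/-- **THE TWIST: the multiplicative eigenvalue is NOT normalisable to `1` by a unit of `S'_c`**
(landed `Negative.multiplicative_unit_normalisation_false`, p163514: `p = 3`, rotation field
`-X₁∂₀ + X₀∂₁` on `𝔽₃(X₀, X₁)`, `u = -1`; `(Dh)² + h·D²h - h² = 1` has constant term `ᾱ² = -1`,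
impossible in `𝔽₃`). Any proof of the multiplicative half must treat the Galois-twisted toric point.
[cite: RudakovShafarevich1976, §1, Thm. 1] -/
theorem not_multUnitNormalisation : ¬ LogCanQuotLUMultUnitNormalisation :=
  Theorems.LogCanQuotLU.Negative.multiplicative_unit_normalisation_false

/-- **In the multiplicative clause the eigenvalue is automatically a constant**: if `E ≠ 0` is a
derivation of a field with `E^[p] = u · E` (pointwise), then `E u = 0` — apply `E` to
`E^[p] x₀ = u · E x₀` for some `x₀` with `E x₀ ≠ 0` and use `E ∘ E^[p] = E^[p] ∘ E`. So the
twisted form `G_u` of `μ_p` attached to a singular multiplicative point is defined over the ring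
of constants. [folklore] -/
theorem apply_eq_zero_of_iterate_eq_mul {k K : Type} [Field k] [Field K] [Algebra k K] {p : ℕ}
    (E : Derivation k K K) (u : K) (hE : ∀ x : K, (⇑E)^[p] x = u * E x) (hE0 : E ≠ 0) :
    E u = 0 := by
  obtain ⟨x₀, hx₀⟩ : ∃ x₀ : K, E x₀ ≠ 0 := by
    by_contra h
    exact hE0 (Derivation.ext fun x => by simpa using not_exists.mp h x)
  have h1 : (⇑E)^[p] (E x₀) = E ((⇑E)^[p] x₀) := by
    rw [← Function.iterate_succ_apply, Function.iterate_succ_apply']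
  rw [hE (E x₀), hE x₀, Derivation.leibniz, smul_eq_mul, smul_eq_mul] at h1
  have h2 : E x₀ * E u = 0 := by linear_combination -h1
  exact (mul_eq_zero.mp h2).resolve_left hx₀

end LoadBearing

end Summit.ResolutionOfSingularities.ResolutionOfSingularities.Cruxes.LogCanQuotLU.Disproof

end
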